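import Mathlib
import Summits.Parity.GeneralizedHardyLittlewood.Theorems.LiouvilleShiftedTablesPairsFromMAvgEulerWeight

/-!
# Sloped ladder, Euler stub — part 2: the weights `G = μ · id · w̃`, `b = G ⋆ 1`, and `∑ |b(n)|/√n ≤ S`

Route `LiouvilleShiftedTables` (Parity / GeneralizedHardyLittlewood), crux stmt-Parity-9389
(`PairsToGHL`), line `sloped_ladder`, stub `stub_slopedEuler`.

Generalisation of the route's `t = 1`, `a = 1` bookkeeping
(`Theorems.PairsFromMAvg.exists_weights`, `exists_sum_abs_div_sqrt_le`) to an arbitrary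
multiplicative weight `w̃` (`weight_mul` of part 1):

* `exists_weights_of_mul` — `G(d) = μ(d) d w̃(d)` and `b = G ⋆ ζ` as real arithmetic functions, both
  multiplicative, `b ⋆ μ = G`, `b(p^k) = 1 - p w̃(p)` (`k ≥ 1`);
* `exists_sum_abs_div_sqrt_le_of_bounds` — if `|b(p^k)| ≤ M` always and `|b(p^k)| ≤ M/p` for
  `p > P₀`, then `∑_{n ≤ N} |b(n)|/√n ≤ S` uniformly in `N` (Euler product over the primes `≤ N`);
* `summable_norm_div_of_sum_le`, `abs_sum_div_sub_tsum_le`, `abs_sum_div_le`, `abs_tsum_div_le` —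
  hence `∑ |b(n)|/n < ∞`, the tail estimate `|∑_{n ≤ D} b(n)/n - ∑_n b(n)/n| ≤ S/√D`, and
  `|∑_{n ≤ D} b(n)/n|, |∑_n b(n)/n| ≤ S`.

[folklore]
-/

noncomputable section

open Finset Real ArithmeticFunction Filter
open scoped ArithmeticFunction.Moebius ArithmeticFunction.zeta

namespace Summit.Parity.GeneralizedHardyLittlewood.Theorems.PairsToGHL.SlopedLadder

open Summit.Parity.GeneralizedHardyLittlewood.Theorems.PairsFromMAvg (sqrt_natCast_pow
  inv_pred_mul_sqrt_pred_le)

/-! ### The weights `G` and `b` -/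

/-- **The weights of the opened rung.** For a weight `w̃` with `w̃(1) = 1`, multiplicative on
coprime pairs of positive integers, there are real arithmetic functions `G`, `b`, both
multiplicative, with `G(d) = μ(d) d w̃(d)`, `b ⋆ μ = G` and `b(p^k) = 1 - p w̃(p)` (`p` prime,
`k ≥ 1`); namely `b = G ⋆ ζ`. [folklore] -/
theorem exists_weights_of_mul (W : ℕ → ℝ) (hW1 : W 1 = 1)
    (hWmul : ∀ m n : ℕ, 0 < m → 0 < n → m.Coprime n → W (m * n) = W m * W n) :
    ∃ G b : ArithmeticFunction ℝ, G.IsMultiplicative ∧ b.IsMultiplicative ∧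
      (∀ d : ℕ, G d = (μ d : ℝ) * d * W d) ∧
      b * (μ : ArithmeticFunction ℝ) = G ∧
      (∀ p k : ℕ, p.Prime → 1 ≤ k → b (p ^ k) = 1 - p * W p) := by
  set G : ArithmeticFunction ℝ := ⟨fun d => (μ d : ℝ) * d * W d, by simp⟩ with hGdef
  have hG : ∀ d : ℕ, G d = (μ d : ℝ) * d * W d := fun d => rfl
  have hG1 : G 1 = 1 := by rw [hG]; simp [hW1]
  have hGm : G.IsMultiplicative := by
    refine ⟨hG1, fun {m n} hmn => ?_⟩
    rcases Nat.eq_zero_or_pos m with rfl | hm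
    · simp [hG]
    rcases Nat.eq_zero_or_pos n with rfl | hn
    · simp [hG]
    rw [hG, hG, hG, isMultiplicative_moebius.map_mul_of_coprime hmn, hWmul m n hm hn hmn]
    push_cast
    ring
  refine ⟨G, G * (ζ : ArithmeticFunction ℝ), hGm, hGm.mul isMultiplicative_zeta.natCast, hG,
    ?_, ?_⟩
  · rw [mul_assoc, coe_zeta_mul_coe_moebius, mul_one]
  · intro p k hp hk
    rw [coe_mul_zeta_apply, Nat.sum_divisors_prime_pow hp]
    have hGp : G p = -(p : ℝ) * W p := by
      rw [hG, moebius_apply_prime hp]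
      push_cast
      ring
    have hGpk : ∀ i, 2 ≤ i → G (p ^ i) = 0 := by
      intro i hi
      rw [hG, moebius_apply_prime_pow hp (by omega), if_neg (by omega)]
      simp
    have hsum : ∀ j, ∑ i ∈ Finset.range (j + 2), G (p ^ i) = 1 + G p := by
      intro j
      induction j with
      | zero => rw [Finset.sum_range_succ, Finset.sum_range_one, pow_zero, pow_one, hG1]
      | succ j ih =>
        rw [show j + 1 + 2 = (j + 2) + 1 by ring, Finset.sum_range_succ, ih, hGpk (j + 2) (by omega),
          add_zero]
    obtain ⟨j, rfl⟩ : ∃ j, k = j + 1 := ⟨k - 1, by omega⟩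
    rw [show j + 1 + 1 = j + 2 by ring, hsum, hGp]
    ring

/-! ### The uniform bound `∑_{n ≤ N} |b(n)|/√n ≤ S` -/

/-- **Uniform bound for `∑ |b(n)|/√n`.** If `b` is multiplicative with `|b(p^k)| ≤ M` for all
prime powers and `|b(p^k)| ≤ M/p` for the primes `p > P₀` (`k ≥ 1`), then
`∑_{n ≤ N} |b(n)|/√n ≤ S` for some `S` independent of `N` (Euler product over the primes `p ≤ N`:
`∏_p ∑_e |b(p^e)| p^{-e/2} ≤ exp(3M(P₀+1) + 8M ∑ n^{-3/2})`). [folklore] -/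
theorem exists_sum_abs_div_sqrt_le_of_bounds (b : ArithmeticFunction ℝ) (hb : b.IsMultiplicative)
    {M : ℝ} {P₀ : ℕ} (hM : 0 ≤ M) (hb1 : ∀ p k : ℕ, p.Prime → 1 ≤ k → |b (p ^ k)| ≤ M)
    (hb2 : ∀ p k : ℕ, p.Prime → 1 ≤ k → P₀ < p → |b (p ^ k)| ≤ M / p) :
    ∃ S : ℝ, ∀ N : ℕ, ∑ n ∈ Icc 1 N, |b n| / Real.sqrt n ≤ S := by
  set f : ℕ → ℝ := fun n => |b n| / Real.sqrt n with hf
  have hf1 : f 1 = 1 := by simp [hf, hb.map_one]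
  have hfmul : ∀ {m n : ℕ}, Nat.Coprime m n → f (m * n) = f m * f n := by
    intro m n hmn
    simp only [hf]
    rw [hb.map_mul_of_coprime hmn, abs_mul, Nat.cast_mul, Real.sqrt_mul (Nat.cast_nonneg _),
      mul_div_mul_comm]
  have hf0 : ∀ n, 0 ≤ f n := fun n => div_nonneg (abs_nonneg _) (Real.sqrt_nonneg _)
  -- the local weight `β_p`
  set βp : ℕ → ℝ := fun p => if p ≤ P₀ then M else M / p with hβp
  have hβ0 : ∀ p, 0 ≤ βp p := fun p => by
    simp only [hβp]; split_ifs <;> positivity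
  have hβM : ∀ p, βp p ≤ M := fun p => by
    simp only [hβp]
    split_ifs
    · exact le_rfl
    · rcases Nat.eq_zero_or_pos p with rfl | hp
      · simp [hM]
      · exact div_le_self hM (by exact_mod_cast hp)
  have hbβ : ∀ {p : ℕ} (e : ℕ), p.Prime → |b (p ^ (e + 1))| ≤ βp p := by
    intro p e hp
    simp only [hβp]
    split_ifs with h
    · exact hb1 p (e + 1) hp (by omega)
    · exact hb2 p (e + 1) hp (by omega) (not_le.mp h)
  have hfpe : ∀ {p : ℕ} (e : ℕ), p.Prime →
      f (p ^ (e + 1)) = |b (p ^ (e + 1))| * ((Real.sqrt p)⁻¹) ^ (e + 1) := by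
    intro p e _
    simp only [hf]
    rw [sqrt_natCast_pow, inv_pow, div_eq_mul_inv]
  have hr : ∀ {p : ℕ}, p.Prime → 0 ≤ (Real.sqrt p)⁻¹ ∧ (Real.sqrt p)⁻¹ ≤ 0.72 := by
    intro p hp
    have hp2 : (2 : ℝ) ≤ p := by exact_mod_cast hp.two_le
    have h14 : (1.4 : ℝ) ≤ Real.sqrt p := by
      refine le_trans ?_ (Real.sqrt_le_sqrt hp2)
      rw [Real.le_sqrt (by norm_num) (by norm_num)]; norm_num
    refine ⟨inv_nonneg.mpr (Real.sqrt_nonneg _), ?_⟩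
    rw [inv_le_comm₀ (by linarith) (by norm_num)]
    exact le_trans (by norm_num) h14
  have hfle : ∀ {p : ℕ} (e : ℕ), p.Prime → f (p ^ e) ≤ (M + 1) * ((Real.sqrt p)⁻¹) ^ e := by
    intro p e hp
    rcases e with _ | e
    · simp [hf1]
      linarith
    · rw [hfpe e hp]
      refine mul_le_mul_of_nonneg_right ?_ (pow_nonneg (hr hp).1 _)
      linarith [hbβ e hp, hβM p]
  have hfsum : ∀ {p : ℕ}, p.Prime → Summable (fun e : ℕ => f (p ^ e)) := by
    intro p hp
    refine Summable.of_nonneg_of_le (fun e => hf0 _) (fun e => hfle e hp)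
      ((summable_geometric_of_lt_one (hr hp).1 (by linarith [(hr hp).2])).mul_left _)
  -- the local factor `T_p = ∑_e f(p^e) ≤ exp(t_p)` with `t_p ≤ 3M·1_{p ≤ P₀} + 8M/(p√p)`
  have hT : ∀ {p : ℕ}, p.Prime → ∑' e : ℕ, f (p ^ e) ≤
      Real.exp ((if p ≤ P₀ then 3 * M else 0) + 8 * M / ((p : ℝ) * Real.sqrt p)) := by
    intro p hp
    have hp2 : (2 : ℝ) ≤ p := by exact_mod_cast hp.two_le
    obtain ⟨hr0, hr1⟩ := hr hp
    set r : ℝ := (Real.sqrt p)⁻¹ with hrdef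
    have hr1' : r < 1 := by linarith
    rw [(hfsum hp).tsum_eq_zero_add, pow_zero, hf1]
    have hgeom : Summable fun e : ℕ => βp p * r * r ^ e :=
      (summable_geometric_of_lt_one hr0 hr1').mul_left _
    have htail : ∑' e : ℕ, f (p ^ (e + 1)) ≤ βp p * r * (1 - r)⁻¹ := by
      have h1 : ∀ e : ℕ, f (p ^ (e + 1)) ≤ βp p * r * r ^ e := by
        intro e
        rw [hfpe e hp, pow_succ]
        calc |b (p ^ (e + 1))| * (r ^ e * r) ≤ βp p * (r ^ e * r) :=
              mul_le_mul_of_nonneg_right (hbβ e hp) (by positivity)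
          _ = βp p * r * r ^ e := by ring
      calc ∑' e : ℕ, f (p ^ (e + 1)) ≤ ∑' e : ℕ, βp p * r * r ^ e :=
            Summable.tsum_le_tsum h1 ((summable_nat_add_iff 1).mpr (hfsum hp)) hgeom
        _ = βp p * r * (1 - r)⁻¹ := by
            rw [tsum_mul_left, tsum_geometric_of_lt_one hr0 hr1']
    refine le_trans ?_ (Real.add_one_le_exp _)
    rw [add_comm]
    refine add_le_add_left (htail.trans ?_) 1
    -- `β_p r/(1-r) ≤ 3M·1_{p ≤ P₀} + 8M/(p√p)`
    have hsp : 0 < Real.sqrt p := Real.sqrt_pos.mpr (by linarith)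
    have hgeo : r * (1 - r)⁻¹ = 1 / (Real.sqrt p - 1) := by
      rw [hrdef]; field_simp
    have h8 : 0 ≤ 8 * M / ((p : ℝ) * Real.sqrt p) := by positivity
    by_cases hP : p ≤ P₀
    · simp only [hβp, if_pos hP]
      have : r * (1 - r)⁻¹ ≤ 3 := by
        rw [mul_inv_le_iff₀ (by linarith)]; linarith
      calc M * r * (1 - r)⁻¹ = M * (r * (1 - r)⁻¹) := by ring
        _ ≤ M * 3 := mul_le_mul_of_nonneg_left this hM
        _ ≤ 3 * M + 8 * M / ((p : ℝ) * Real.sqrt p) := by linarith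
    · simp only [hβp, if_neg hP, zero_add]
      have hp0 : (0 : ℝ) < p := by linarith
      calc M / p * r * (1 - r)⁻¹ = M * ((1 / p) * (r * (1 - r)⁻¹)) := by ring
        _ ≤ M * (1 / (p - 1) * (1 / (Real.sqrt p - 1))) := by
            rw [hgeo]
            refine mul_le_mul_of_nonneg_left (mul_le_mul_of_nonneg_right ?_ ?_) hM
            · exact one_div_le_one_div_of_le (by linarith) (by linarith)
            · have hsq1 : 1 < Real.sqrt p := by
                rw [show (1 : ℝ) = Real.sqrt 1 from Real.sqrt_one.symm]
                exact Real.sqrt_lt_sqrt (by norm_num) (by linarith)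
              rw [one_div_nonneg]; linarith
        _ = M * (1 / ((p - 1) * (Real.sqrt p - 1))) := by rw [one_div_mul_one_div]
        _ ≤ M * (8 / (p * Real.sqrt p)) :=
            mul_le_mul_of_nonneg_left (inv_pred_mul_sqrt_pred_le hp2) hM
        _ = 8 * M / ((p : ℝ) * Real.sqrt p) := by ring
  -- summing `t_p` over the primes `p ≤ N`
  have hZ : Summable (fun n : ℕ => 8 / ((n : ℝ) * Real.sqrt n)) := by
    have := (Real.summable_one_div_nat_rpow.mpr (by norm_num : (1 : ℝ) < 3 / 2)).mul_left 8
    refine this.congr fun n => ?_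
    rw [show (3 / 2 : ℝ) = 1 + 1 / 2 by norm_num, Real.rpow_add' (Nat.cast_nonneg n) (by norm_num),
      Real.rpow_one, ← Real.sqrt_eq_rpow]
    ring
  set Z : ℝ := ∑' n : ℕ, 8 / ((n : ℝ) * Real.sqrt n) with hZdef
  refine ⟨Real.exp (3 * M * (P₀ + 1) + M * Z), fun N => ?_⟩
  set s : Finset ℕ := (Finset.range (N + 1)).filter Nat.Prime with hs
  have hsp : ∀ p ∈ s, p.Prime := fun p hp => (Finset.mem_filter.mp hp).2
  have hfact : ∀ d ∈ Icc 1 N, d ∈ Nat.factoredNumbers s := by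
    intro d hd
    obtain ⟨hd1, hdN⟩ := Finset.mem_Icc.mp hd
    rw [Nat.mem_factoredNumbers']
    intro p hp hpd
    rw [hs, Finset.mem_filter, Finset.mem_range]
    exact ⟨Nat.lt_succ_of_le ((Nat.le_of_dvd hd1 hpd).trans hdN), hp⟩
  have hle := Literature.NumberTheory.Sieve.BombieriSieve.sum_le_prod_tsum_of_factored
    (h := f) hf1 hfmul hf0 hfsum hsp hfact
  refine hle.trans ?_
  calc ∏ p ∈ s, ∑' e : ℕ, f (p ^ e)
      ≤ ∏ p ∈ s, Real.exp ((if p ≤ P₀ then 3 * M else 0) + 8 * M / ((p : ℝ) * Real.sqrt p)) :=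
        Finset.prod_le_prod (fun p _ => tsum_nonneg fun e => hf0 _) fun p hp => hT (hsp p hp)
    _ = Real.exp (∑ p ∈ s, ((if p ≤ P₀ then 3 * M else 0) + 8 * M / ((p : ℝ) * Real.sqrt p))) :=
        (Real.exp_sum _ _).symm
    _ ≤ Real.exp (3 * M * (P₀ + 1) + M * Z) := by
        refine Real.exp_le_exp.mpr ?_
        rw [Finset.sum_add_distrib]
        refine add_le_add ?_ ?_
        · rw [← Finset.sum_filter, Finset.sum_const, nsmul_eq_mul]
          have hcard : ((s.filter (· ≤ P₀)).card : ℝ) ≤ P₀ + 1 := by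
            have h1 : s.filter (· ≤ P₀) ⊆ Finset.range (P₀ + 1) := by
              intro p hp
              rw [Finset.mem_filter] at hp
              exact Finset.mem_range.mpr (Nat.lt_succ_of_le hp.2)
            have := Finset.card_le_card h1
            rw [Finset.card_range] at this
            exact_mod_cast this
          nlinarith
        · have h8 : ∀ p ∈ s, 8 * M / ((p : ℝ) * Real.sqrt p) = M * (8 / ((p : ℝ) * Real.sqrt p)) :=
            fun p _ => by ring
          rw [Finset.sum_congr rfl h8, ← Finset.mul_sum]
          exact mul_le_mul_of_nonneg_left
            (Summable.sum_le_tsum s (fun n _ => by positivity) hZ) hM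

/-! ### Consequences of the uniform bound: summability and tails of `∑ b(n)/n` -/

/-- `∑_n |b(n)|/√n < ∞` from the uniform bound on the partial sums. [folklore] -/
theorem summable_abs_div_sqrt_of_sum_le (b : ArithmeticFunction ℝ) {S : ℝ}
    (hS : ∀ N, ∑ n ∈ Icc 1 N, |b n| / Real.sqrt n ≤ S) :
    Summable (fun n : ℕ => |b n| / Real.sqrt n) := by
  refine summable_of_sum_le (c := S) (fun n => div_nonneg (abs_nonneg _) (Real.sqrt_nonneg _))
    fun u => ?_
  have h0 : (fun n : ℕ => |b n| / Real.sqrt n) 0 = 0 := by simp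
  rw [← Finset.sum_erase u h0]
  calc ∑ n ∈ u.erase 0, |b n| / Real.sqrt n ≤ ∑ n ∈ Icc 1 (u.sup id), |b n| / Real.sqrt n := by
        refine Finset.sum_le_sum_of_subset_of_nonneg (fun n hn => ?_)
          fun n _ _ => div_nonneg (abs_nonneg _) (Real.sqrt_nonneg _)
        obtain ⟨hn0, hnu⟩ := Finset.mem_erase.mp hn
        exact Finset.mem_Icc.mpr ⟨Nat.pos_of_ne_zero hn0, Finset.le_sup (f := id) hnu⟩
    _ ≤ S := hS _

/-- `|b(n)|/n ≤ |b(n)|/√n`. [folklore] -/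
theorem norm_div_le_abs_div_sqrt (b : ArithmeticFunction ℝ) (n : ℕ) :
    ‖b n / n‖ ≤ |b n| / Real.sqrt n := by
  rcases Nat.eq_zero_or_pos n with rfl | hn
  · simp
  · have hn0 : (0 : ℝ) < n := by exact_mod_cast hn
    rw [Real.norm_eq_abs, abs_div, Nat.abs_cast]
    refine div_le_div_of_nonneg_left (abs_nonneg _) (Real.sqrt_pos.mpr hn0) ?_
    have hsq1 : 1 ≤ Real.sqrt n := by
      rw [← Real.sqrt_one]; exact Real.sqrt_le_sqrt (by exact_mod_cast hn)
    calc Real.sqrt n = Real.sqrt n * 1 := (mul_one _).symm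
      _ ≤ Real.sqrt n * Real.sqrt n := by gcongr
      _ = n := Real.mul_self_sqrt hn0.le

/-- `∑_n |b(n)|/n < ∞` from the uniform bound on `∑_{n ≤ N} |b(n)|/√n`. [folklore] -/
theorem summable_norm_div_of_sum_le (b : ArithmeticFunction ℝ) {S : ℝ}
    (hS : ∀ N, ∑ n ∈ Icc 1 N, |b n| / Real.sqrt n ≤ S) :
    Summable (fun n : ℕ => ‖b n / n‖) :=
  Summable.of_nonneg_of_le (fun _ => norm_nonneg _) (norm_div_le_abs_div_sqrt b)
    (summable_abs_div_sqrt_of_sum_le b hS)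

/-- **Tail of `∑ b(n)/n`.** `|∑_{n ≤ D} b(n)/n - ∑_n b(n)/n| ≤ S/√D` for `D ≥ 1`: the tail is
`∑_{n > D} |b(n)|/√n · n^{-1/2} ≤ D^{-1/2} S`. [folklore] -/
theorem abs_sum_div_sub_tsum_le (b : ArithmeticFunction ℝ) {S : ℝ}
    (hS : ∀ N, ∑ n ∈ Icc 1 N, |b n| / Real.sqrt n ≤ S) {D : ℕ} (hD : 0 < D) :
    |∑ n ∈ Icc 1 D, b n / n - ∑' n : ℕ, b n / n| ≤ S / Real.sqrt D := by
  set f : ℕ → ℝ := fun n => b n / n with hf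
  set g : ℕ → ℝ := fun n => |b n| / Real.sqrt n with hg
  have hg0 : ∀ n, 0 ≤ g n := fun n => div_nonneg (abs_nonneg _) (Real.sqrt_nonneg _)
  have hgs : Summable g := summable_abs_div_sqrt_of_sum_le b hS
  have hfn : Summable (fun n => ‖f n‖) := summable_norm_div_of_sum_le b hS
  have hfs : Summable f := hfn.of_norm
  have hS0 : 0 ≤ S := by simpa using hS 0
  have hD0 : (0 : ℝ) < D := by exact_mod_cast hD
  have hsqD : 0 < Real.sqrt D := Real.sqrt_pos.mpr hD0
  -- `∑_{n ≤ D} f = ∑_{n < D+1} f`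
  have hIcc : ∑ n ∈ Icc 1 D, f n = ∑ n ∈ Finset.range (D + 1), f n := by
    rw [Finset.sum_range_eq_add_Ico _ (by omega : 0 < D + 1), Finset.Ico_add_one_right_eq_Icc]
    have h0 : f 0 = 0 := by simp [hf]
    rw [h0, zero_add]
  have htail := hfs.sum_add_tsum_nat_add (D + 1)
  have hdiff : ∑ n ∈ Icc 1 D, f n - ∑' n : ℕ, f n = -∑' i : ℕ, f (i + (D + 1)) := by
    rw [hIcc, ← htail]; ring
  rw [hdiff, abs_neg]
  -- termwise: `|f(m)| ≤ g(m)/√D` for `m > D`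
  have hterm : ∀ i : ℕ, ‖f (i + (D + 1))‖ ≤ g (i + (D + 1)) / Real.sqrt D := by
    intro i
    set m : ℕ := i + (D + 1) with hm
    have hm0 : (0 : ℝ) < m := by rw [hm]; positivity
    have hsqm : Real.sqrt D ≤ Real.sqrt m :=
      Real.sqrt_le_sqrt (by rw [hm]; push_cast; linarith)
    simp only [hf, hg]
    rw [Real.norm_eq_abs, abs_div, Nat.abs_cast, div_div]
    refine div_le_div_of_nonneg_left (abs_nonneg _) (mul_pos (Real.sqrt_pos.mpr hm0) hsqD) ?_
    calc Real.sqrt m * Real.sqrt D ≤ Real.sqrt m * Real.sqrt m := by gcongr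
      _ = m := Real.mul_self_sqrt hm0.le
  have hgtail : Summable fun i : ℕ => g (i + (D + 1)) := (summable_nat_add_iff (f := g) (D + 1)).mpr hgs
  have hftail : Summable fun i : ℕ => ‖f (i + (D + 1))‖ :=
    (summable_nat_add_iff (f := fun n => ‖f n‖) (D + 1)).mpr hfn
  have hgle : ∑' i : ℕ, g (i + (D + 1)) ≤ S := by
    refine Real.tsum_le_of_sum_range_le (fun i => hg0 _) fun k => ?_
    have hshift : ∑ i ∈ Finset.range k, g (i + (D + 1)) =
        ∑ n ∈ Finset.Ico (D + 1) (D + 1 + k), g n := by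
      rw [Finset.sum_Ico_eq_sum_range, Nat.add_sub_cancel_left]
      exact Finset.sum_congr rfl fun i _ => by rw [add_comm]
    rw [hshift]
    calc ∑ n ∈ Finset.Ico (D + 1) (D + 1 + k), g n ≤ ∑ n ∈ Icc 1 (D + k), g n := by
          refine Finset.sum_le_sum_of_subset_of_nonneg (fun n hn => ?_) fun n _ _ => hg0 n
          rw [Finset.mem_Ico] at hn
          rw [Finset.mem_Icc]; omega
      _ ≤ S := hS _
  calc |∑' i : ℕ, f (i + (D + 1))| = ‖∑' i : ℕ, f (i + (D + 1))‖ := (Real.norm_eq_abs _).symm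
    _ ≤ ∑' i : ℕ, ‖f (i + (D + 1))‖ := norm_tsum_le_tsum_norm hftail
    _ ≤ ∑' i : ℕ, g (i + (D + 1)) / Real.sqrt D :=
        Summable.tsum_le_tsum hterm hftail (hgtail.div_const _)
    _ = (∑' i : ℕ, g (i + (D + 1))) / Real.sqrt D := tsum_div_const
    _ ≤ S / Real.sqrt D := div_le_div_of_nonneg_right hgle hsqD.le

/-- `|∑_{n ≤ D} b(n)/n| ≤ S`. [folklore] -/
theorem abs_sum_div_le (b : ArithmeticFunction ℝ) {S : ℝ}
    (hS : ∀ N, ∑ n ∈ Icc 1 N, |b n| / Real.sqrt n ≤ S) (D : ℕ) :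
    |∑ n ∈ Icc 1 D, b n / n| ≤ S := by
  calc |∑ n ∈ Icc 1 D, b n / n| ≤ ∑ n ∈ Icc 1 D, |b n / n| := abs_sum_le_sum_abs _ _
    _ ≤ ∑ n ∈ Icc 1 D, |b n| / Real.sqrt n :=
        Finset.sum_le_sum fun n _ => (Real.norm_eq_abs _).symm.le.trans (norm_div_le_abs_div_sqrt b n)
    _ ≤ S := hS D

/-- `|∑_n b(n)/n| ≤ S`. [folklore] -/
theorem abs_tsum_div_le (b : ArithmeticFunction ℝ) {S : ℝ}
    (hS : ∀ N, ∑ n ∈ Icc 1 N, |b n| / Real.sqrt n ≤ S) :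
    |∑' n : ℕ, b n / n| ≤ S := by
  have hgs := summable_abs_div_sqrt_of_sum_le b hS
  have hfn := summable_norm_div_of_sum_le b hS
  calc |∑' n : ℕ, b n / n| = ‖∑' n : ℕ, b n / n‖ := (Real.norm_eq_abs _).symm
    _ ≤ ∑' n : ℕ, ‖b n / n‖ := norm_tsum_le_tsum_norm hfn
    _ ≤ ∑' n : ℕ, |b n| / Real.sqrt n := Summable.tsum_le_tsum (norm_div_le_abs_div_sqrt b) hfn hgs
    _ ≤ S := by
        refine Real.tsum_le_of_sum_range_le
          (fun n => div_nonneg (abs_nonneg _) (Real.sqrt_nonneg _)) fun k => ?_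
        rcases Nat.eq_zero_or_pos k with rfl | hk
        · simpa using hS 0
        · rw [Finset.sum_range_eq_add_Ico _ hk]
          simp only [Nat.cast_zero, Real.sqrt_zero, div_zero, zero_add]
          calc ∑ n ∈ Finset.Ico 1 k, |b n| / Real.sqrt n ≤ ∑ n ∈ Icc 1 k, |b n| / Real.sqrt n :=
                Finset.sum_le_sum_of_subset_of_nonneg (fun n hn => by
                  rw [Finset.mem_Ico] at hn; rw [Finset.mem_Icc]; omega)
                  fun n _ _ => div_nonneg (abs_nonneg _) (Real.sqrt_nonneg _)
            _ ≤ S := hS k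

/-! ### Registered sub-goal of this helper file -/

/-- **Part 2 of `stub_slopedEuler` (registered sub-goal `stub_slopedEuler_part2`).** The uniform
bound `∑_{n ≤ N} |b(n)|/√n ≤ S` for a multiplicative `b` with `|b(p^k)| ≤ M` always and
`|b(p^k)| ≤ M/p` beyond `P₀`. [folklore] -/
theorem stub_slopedEuler_part2 :
    ∀ (b : ArithmeticFunction ℝ), b.IsMultiplicative → ∀ (M : ℝ) (P₀ : ℕ), 0 ≤ M → (∀ p k : ℕ, p.Prime → 1 ≤ k → |b (p ^ k)| ≤ M) → (∀ p k : ℕ, p.Prime → 1 ≤ k → P₀ < p → |b (p ^ k)| ≤ M / p) → ∃ S : ℝ, ∀ N : ℕ, ∑ n ∈ Finset.Icc 1 N, |b n| / Real.sqrt n ≤ S :=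
  fun b hb _ _ hM hb1 hb2 => exists_sum_abs_div_sqrt_le_of_bounds b hb hM hb1 hb2

end Summit.Parity.GeneralizedHardyLittlewood.Theorems.PairsToGHL.SlopedLadder
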